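import Summits.CriticalPhenomena.PercolationContinuityZ3.Theses.PercNearOneGluing
import Literature.Probability.Percolation.PercolationProofs
import Literature.Probability.Percolation.ConditionalPositiveAssociationProofs
import Literature.Probability.Percolation.TwoClusterConditionalAssociationProofs
import Summits.CriticalPhenomena.PercolationContinuityZ3.Theorems.PercNearOneGluingAdditiveGluingGoodTwoRelays

/-! TTRL-lite variant V2068 of stmt-CriticalPhenomena-4576

(`stub_goodStep` / `cp4576-goodstep`, move `specialise+small_case`: `n := 4` and `A.card ≤ 4`).
On four vertices with `o ∉ A` the relay set has at most three elements, so the additive gluing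
good step is exactly the proved two-relay case `stub_goodStepTwoRelays_k41` (`A.card ≤ 3`);
neither the low-neighbour hypothesis nor the induction hypothesis is needed.
No new definitions, no named facts. -/

namespace Summit.CriticalPhenomena.PercolationContinuityZ3.Theorems

open MeasureTheory Literature.Probability.LatticeModels Literature.Probability.Percolation
open scoped Classical BigOperators

/-- TTRL-lite variant V2068 of `stub_goodStep` (stmt-CriticalPhenomena-4576): the inductive step of
the good-quadruple inequality on four vertices (the hypothesis `A.card ≤ 4` is vacuous).  Since
`o ∉ A ⊆ Fin 4` forces `A.card ≤ 3`, this is a special case of the proved two-relay good step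
`stub_goodStepTwoRelays_k41`; the low-neighbour and induction hypotheses are discarded. -/
theorem cp4576_goodstep_var2068 : ∀ (w : Sym2 (Fin 4) → unitInterval) (A : Finset (Fin 4)) (o b : Fin 4), A.card ≤ 4 → b ∈ A → o ∉ A → (∃ y : Fin 4, y ∉ A ∧ y ≠ o ∧ (w s(o, y) : ℝ) ≠ 0) → (∀ w' : Sym2 (Fin 4) → unitInterval, (Finset.univ.filter (fun v : Fin 4 => ∃ u : Fin 4, 0 < (w' s(u, v) : ℝ))).card < (Finset.univ.filter (fun v : Fin 4 => ∃ u : Fin 4, 0 < (w s(u, v) : ℝ))).card → ∀ (A' : Finset (Fin 4)) (o' b' : Fin 4), b' ∈ A' → o' ∉ A' → ∀ (t : ℝ) (sel : Finset (Fin 4) → Fin 4), (∀ W, sel W ∈ A') → (∀ a ∈ A', 1 - t ≤ (prodBernoulli w').real (openConn a b')) → (prodBernoulli w').real ((⋃ a ∈ A', openConn o' a) ∩ (openConn o' b')ᶜ) + ∑ W ∈ (Finset.univ : Finset (Finset (Fin 4))).filter (fun W => o' ∈ W ∧ Disjoint W A'), (prodBernoulli w').real {ω : BondConfig (Fin 4)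 | openCluster ω o' = (W : Set (Fin 4))} * (prodBernoulli w').real (openConnIn ((W : Set (Fin 4))ᶜ) (sel W) b')ᶜ ≤ t) → ∀ (t : ℝ) (sel : Finset (Fin 4) → Fin 4), (∀ W, sel W ∈ A) → (∀ a ∈ A, 1 - t ≤ (prodBernoulli w).real (openConn a b)) → (prodBernoulli w).real ((⋃ a ∈ A, openConn o a) ∩ (openConn o b)ᶜ) + ∑ W ∈ (Finset.univ : Finset (Finset (Fin 4))).filter (fun W => o ∈ W ∧ Disjoint W A), (prodBernoulli w).real {ω : BondConfig (Fin 4) | openCluster ω o = (W : Set (Fin 4))} * (prodBernoulli w).real (openConnIn ((W : Set (Fin 4))ᶜ) (sel W) b)ᶜ ≤ t := by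
  intro w A o b _hcard hbA hoA _hy _hIH t sel hsel hlev
  -- `o ∉ A ⊆ Fin 4` leaves at most three relays
  have hcard3 : A.card ≤ 3 := by
    have hsub : A ⊆ (Finset.univ : Finset (Fin 4)).erase o := fun x hx =>
      Finset.mem_erase.2 ⟨fun h => hoA (h ▸ hx), Finset.mem_univ x⟩
    have h := Finset.card_le_card hsub
    rw [Finset.card_erase_of_mem (Finset.mem_univ o), Finset.card_univ, Fintype.card_fin] at h
    omega
  exact stub_goodStepTwoRelays_k41 4 w A o b hbA hoA hcard3 t sel hsel hlev

end Summit.CriticalPhenomena.PercolationContinuityZ3.Theorems
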